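import Summits.ResolutionOfSingularities.ResolutionOfSingularities.Theorems.HilbertSamuelEliminationSigmaMaxModificationsCorridor3WLadderIsoTailsFreeRationalHyp
import Summits.ResolutionOfSingularities.ResolutionOfSingularities.Theorems.HilbertSamuelEliminationSigmaMaxModificationsCorridor3WLadderIsoTailsHSArcMinimalPrimes
import Literature.AlgebraicGeometry.Resolution.CatenaryRings
import Literature.AlgebraicGeometry.Resolution.CohenMacaulayCatenary
import HarnessLib

/-!
# [OURS · L1 W4.2] D14 ROUTE G v2 — **H∞-FINAL-G (binder form)** (object G2f, first half): an isolated point tower whose stage `n₀` is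
# a quotient of a regular local ring admits NO regular formal arc with Bennett's equality — in EVERY embedding dimension
# (crux `SigmaMaxModifications` stmt-ResolutionOfSingularities-18506 / conjunct stmt-…-19249; kernel K1 `IsoFreeRationalTailsImpossible`;
# res-L1-w42-plan-1 RULING v3.14-20 (FO) «G2e hI + G2f ASSEMBLY H∞-FINAL-G := 001», res-L1-w42-lead-1 ROUTE-G-ARCLIMIT §4)

Prover res-type-001 (gen 8). Helper file `--supports stmt-ResolutionOfSingularities-19249 --as helper`; kernel only, no definitions, no named
fact. OURS (cell res-hironaka, slot W4.2); NOT statements of [Hironaka2017] nor of [CossartJannsenSaito2020] / [CossartPiltant2009]. AI-written;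
AI review is weaker than expert review.

## What is proved

* **`false_of_isIsoPointTower_of_stage_of_bennettArc`** — the embedding-dimension-free twin of H∞-FINAL (`…IsoTailsFreeRationalHyp`,
  rev 1). Data: `(T, pt)` an isolated point tower at level `3` over a maximal origin (`IsMaximalOrigin p 3 ν (T.X 0) (pt 0)`,
  `IsIsoPointTower 3 ν T pt`); a stage `n₀` whose local ring `𝒪 = 𝒪_{X_{n₀},x_{n₀}}` is presented as a quotient of a REGULAR local ring,
  `e : 𝒪 ≃+* R ⧸ I` (ANY `I`: res-type-071's presentations in every embedding dimension; the hypothesis of res-D-pv-010's H8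
  `isIsolatedInHSMaxLocus_adicCompletion_of_ringEquiv`); a FORMAL MODEL `e′ : S ⧸ J ≃+* 𝒪̂` with `S` regular local (the common formal
  frame `S = κ⟦t, y⟧`, `J = J₀` the frame image of `ker σ₀` — lead-1's ROUTE-G-ARCLIMIT §1); and a prime `P ⊇ J` of `S` with `S ⧸ P`
  regular of dimension `1` (the arc) carrying BENNETT'S EQUALITY `H^{(1)}[(S/J)_{P̄}] = H^{(0)}[S/J]` — the output of lead-1's G2c «limit
  inequality». Conclusion: `False`: H8 makes the closed point of `Spec 𝒪̂ ≅ Spec S/J` isolated in the Hilbert–Samuel locus, while the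
  ROUTE-G end (res-type-001's p528484 with `hI` discharged by G2e `minimalPrimes_le_of_hilbertSamuelFun_eq`) says the arc point lies in its
  stratum.
* `false_of_isIsoPointTower_of_stage_of_isNormallyFlat_arc` — the same with «`S/J` normally flat along `P̄`» in place of Bennett's equality.

What is NOT here (G2f second half, after G2a/G2b/G2c land): the instantiation `S := κ⟦X₀, …, X_d⟧`, `J := ψ₀(ker σ₀)·S`, `e′` through res-type-038's
Cohen coordinates (`S ⧸ J ≃ R̂ ⧸ I R̂ ≃ (R ⧸ I)^ ≃ 𝒪̂`, Matsumura 8.11), `P :=` the sheared arc prime, and `hH :=` G2c.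

[OURS · L1 W4.2; AI-written]
-/

set_option linter.dupNamespace false

noncomputable section

open CategoryTheory AlgebraicGeometry TopologicalSpace IsLocalRing
open Literature.AlgebraicGeometry.Resolution Literature.RingTheory.HilbertSamuel
open Literature.AlgebraicGeometry.CossartJannsenSaito2020
open Summit.ResolutionOfSingularities.ResolutionOfSingularities.Theorems.CampaignW42
open Summit.ResolutionOfSingularities.ResolutionOfSingularities.Theorems.SigmaMaxModificationsCorridor3
open Summit.ResolutionOfSingularities.ResolutionOfSingularities.Cruxes.SigmaMaxModifications
open Summit.ResolutionOfSingularities.ResolutionOfSingularities.Cruxes.SigmaMaxModifications.IdeasL1C4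
open Summit.ResolutionOfSingularities.ResolutionOfSingularities.Cruxes.SigmaMaxModifications.IdeasL1Idea2R4

namespace Summit.ResolutionOfSingularities.ResolutionOfSingularities.Theorems.SigmaMaxModificationsCorridor3.IsoTailsHS

universe u

/-- **H∞-FINAL-G (binder form): no Bennett arc in a formal model of a stage of an isolated point tower** — see the module docstring.
Steps: (1) `x_{n₀}` isolated in `(X_{n₀})_max` ⇒ the closed point of `Spec 𝒪` is (`isIsolatedInHSMaxLocus_spec_stalk_of_isIsoPointTower`);
(2) ⇒ so is the closed point of `Spec 𝒪̂` (res-D-pv-010's H8, `𝒪` excellent of dimension `≤ 3`, `𝒪 ≅ R/I`); (3) transport along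
`e′ : S/J ≅ 𝒪̂`; (4) but `S/J` is catenary (quotient of a regular local ring), `P̄ = P/J` is a prime `≠ 𝔪` with `(S/J)/P̄ ≅ S/P` regular of
dimension `1`, every minimal prime of `S/J` lies in `P̄` (G2e), `ψ(S/J) ≤ dim ≤ 3`, and Bennett's equality holds — so the closed point is NOT
isolated (`not_isIsolatedInHSMaxLocus_closedPoint_of_hilbertSamuelFun_eq'`). [OURS · L1 W4.2; AI-written]
[cite: CossartJannsenSaito2020, Def. 13.3, Thm. 3.3] [cite: HerrmannIkedaOrbanz1988, Thm. (22.24)] -/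
theorem false_of_isIsoPointTower_of_stage_of_bennettArc {p : ℕ} {ν : ℕ → ℕ} {T : BlowupTower.{u}} {pt : ∀ n, T.X n}
    (hO : IsMaximalOrigin p 3 ν (T.X 0) (pt 0)) (hT : IsIsoPointTower 3 ν T pt) (n₀ : ℕ)
    {R : Type u} [CommRing R] [IsRegularLocalRing R] (I : Ideal R) (e : ↥((T.X n₀).presheaf.stalk (pt n₀)) ≃+* R ⧸ I)
    {S : Type u} [CommRing S] [IsRegularLocalRing S] (J : Ideal S) [IsLocalRing (S ⧸ J)]
    (e' : (S ⧸ J) ≃+* AdicCompletion (maximalIdeal ↥((T.X n₀).presheaf.stalk (pt n₀))) ↥((T.X n₀).presheaf.stalk (pt n₀)))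
    (P : Ideal S) [P.IsPrime] [IsRegularLocalRing (S ⧸ P)] (hP1 : ringKrullDim (S ⧸ P) = (1 : ℕ)) (hJP : J ≤ P)
    [(P.map (Ideal.Quotient.mk J)).IsPrime]
    (hH : hilbertSamuelFun (Localization.AtPrime (P.map (Ideal.Quotient.mk J))) 1 = hilbertFun (S ⧸ J)) : False := by
  haveI : IsLocallyNoetherian (T.X n₀) := T.ln n₀
  -- (1)+(2): isolation in `Spec 𝒪̂`
  have hexc : Scheme.IsExcellent (T.X n₀) := isExcellent_X T (isExcellent_of_isMaximalOrigin hO) n₀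
  have hA : IsExcellentRing ((T.X n₀).presheaf.stalk (pt n₀)) := isExcellentRing_stalk_of_isExcellent hexc (pt n₀)
  have hdim : ringKrullDim ((T.X n₀).presheaf.stalk (pt n₀)) ≤ ((3 : ℕ) : WithBot ℕ∞) :=
    ringKrullDim_stalk_le T hO.dim_le n₀ (pt n₀)
  have hiso := isIsolatedInHSMaxLocus_spec_stalk_of_isIsoPointTower hO hT n₀
  have hisoC := isIsolatedInHSMaxLocus_adicCompletion_of_ringEquiv ((T.X n₀).presheaf.stalk (pt n₀)) hA I e 3 hdim hiso
  -- (3): transport to `Spec (S ⧸ J)`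
  have hisoS : IsIsolatedInHSMaxLocus (Spec (CommRingCat.of (S ⧸ J))) 3 (closedPoint (S ⧸ J)) :=
    Moving.isIsolatedInHSMaxLocus_spec_of_iso
      (A := CommRingCat.of (AdicCompletion (maximalIdeal ↥((T.X n₀).presheaf.stalk (pt n₀))) ↥((T.X n₀).presheaf.stalk (pt n₀))))
      (B := CommRingCat.of (S ⧸ J)) e'.symm.toCommRingCatIso 3 hisoC
  -- (4): the ROUTE-G end on `S ⧸ J`
  have hcat : IsCatenaryRing (S ⧸ J) := (isCatenaryRing_of_isRegularLocalRing S).quotient J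
  let q : (S ⧸ J) ⧸ P.map (Ideal.Quotient.mk J) ≃+* S ⧸ P := DoubleQuot.quotQuotEquivQuotOfLE hJP
  haveI : IsRegularLocalRing ((S ⧸ J) ⧸ P.map (Ideal.Quotient.mk J)) := IsRegularLocalRing.of_ringEquiv q.symm
  have hr : ringKrullDim ((S ⧸ J) ⧸ P.map (Ideal.Quotient.mk J)) = (1 : ℕ) := by
    rw [ringKrullDim_eq_of_ringEquiv q, hP1]
  have hPm : P.map (Ideal.Quotient.mk J) ≠ maximalIdeal (S ⧸ J) := by
    intro heq
    have hdim1 : ringKrullDim ((S ⧸ J) ⧸ maximalIdeal (S ⧸ J)) = (1 : ℕ) := heq ▸ hr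
    letI := Ideal.Quotient.field (maximalIdeal (S ⧸ J))
    rw [ringKrullDim_eq_zero_of_field] at hdim1
    exact absurd hdim1 (by norm_num)
  -- `ψ(S/J) ≤ dim (S/J) = dim 𝒪̂ = dim 𝒪 ≤ 3`
  have hN : minimalPrimesCodim (S ⧸ J) ≤ 3 := by
    have h1 := minimalPrimesCodim_le_ringKrullDim (S ⧸ J)
    rw [ringKrullDim_eq_of_ringEquiv e', ringKrullDim_adicCompletion] at h1
    exact_mod_cast h1.trans hdim
  exact not_isIsolatedInHSMaxLocus_closedPoint_of_hilbertSamuelFun_eq' hcat (P.map (Ideal.Quotient.mk J)) hPm hr hH hN hisoS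

/-- **H∞-FINAL-G (binder form), normal-flatness currency**: as `false_of_isIsoPointTower_of_stage_of_bennettArc` with «`S ⧸ J` is normally
flat along `P̄`» (CJS Def. 3.1) instead of Bennett's equality. [OURS · L1 W4.2; AI-written] [cite: CossartJannsenSaito2020, Def. 3.1, Thm. 3.3] -/
theorem false_of_isIsoPointTower_of_stage_of_isNormallyFlat_arc {p : ℕ} {ν : ℕ → ℕ} {T : BlowupTower.{u}} {pt : ∀ n, T.X n}
    (hO : IsMaximalOrigin p 3 ν (T.X 0) (pt 0)) (hT : IsIsoPointTower 3 ν T pt) (n₀ : ℕ)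
    {R : Type u} [CommRing R] [IsRegularLocalRing R] (I : Ideal R) (e : ↥((T.X n₀).presheaf.stalk (pt n₀)) ≃+* R ⧸ I)
    {S : Type u} [CommRing S] [IsRegularLocalRing S] (J : Ideal S) [IsLocalRing (S ⧸ J)]
    (e' : (S ⧸ J) ≃+* AdicCompletion (maximalIdeal ↥((T.X n₀).presheaf.stalk (pt n₀))) ↥((T.X n₀).presheaf.stalk (pt n₀)))
    (P : Ideal S) [P.IsPrime] [IsRegularLocalRing (S ⧸ P)] (hP1 : ringKrullDim (S ⧸ P) = (1 : ℕ)) (hJP : J ≤ P)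
    [(P.map (Ideal.Quotient.mk J)).IsPrime] (hNF : (P.map (Ideal.Quotient.mk J)).IsNormallyFlat) : False := by
  let q : (S ⧸ J) ⧸ P.map (Ideal.Quotient.mk J) ≃+* S ⧸ P := DoubleQuot.quotQuotEquivQuotOfLE hJP
  haveI : IsRegularLocalRing ((S ⧸ J) ⧸ P.map (Ideal.Quotient.mk J)) := IsRegularLocalRing.of_ringEquiv q.symm
  have hr : ringKrullDim ((S ⧸ J) ⧸ P.map (Ideal.Quotient.mk J)) = (1 : ℕ) := by
    rw [ringKrullDim_eq_of_ringEquiv q, hP1]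
  exact false_of_isIsoPointTower_of_stage_of_bennettArc hO hT n₀ I e J e' P hP1 hJP
    (hilbertFun_eq_hilbertSamuelFun_of_isNormallyFlat (P.map (Ideal.Quotient.mk J))
      (Localization.AtPrime (P.map (Ideal.Quotient.mk J))) hr hNF).symm

end Summit.ResolutionOfSingularities.ResolutionOfSingularities.Theorems.SigmaMaxModificationsCorridor3.IsoTailsHS

end
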